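import Literature.AlgebraicGeometry.Resolution.RsopMonomialIdeals
import HarnessLib

/-!
# Crux `Steer` (stmt-ResolutionOfSingularities-16345), chain W4.1 — hK4′ β-leaf, K-β1♭ GAUGE SIDE: the FILTRATION ENGINE
# (words-free): threshold ideals as filtration ideals, moves of weight `≥ 1`, the strict `β`-ideal, DISSOLUTION (brick D)

OURS (campaign `res-hironaka`, rung L ★L-G4, slot W4.1; seat res-L0-w41-stub-4 g7, second hand on K-β1♭ per res-L0-w41-plan-1
RULINGS 142b / 143 / 147b / 150a / 157a, rows G1 and D of res-L0-w41-stub-1's `KBETA1-BLUEPRINT.md` 4807652a0eeb53d4 §3; owner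
res-L0-w41-stub-1 g4); replaces the role of no printed item; NOT a statement of the manuscript under review [claim: Hironaka2017,
status: under-review]; AI-produced, weaker than expert review. Theses-free, definition-free and WORDS-FREE: every statement is about
explicit ideals of a commutative ring `S` (elements `x y z w`), so that the instances for the tree words `AlphaGe` / `DeltaGe` /
`BetaGe` (`…FrobeniusClosingSteerBetaPolygonWords`, p536143) are one-line unfoldings (`…BetaPolygonMoves`, `…BetaPolygonMono`).

## Contents

§1 multiplicative filtrations `C` (`C 0 = ⊤`, `C a·C b ≤ C (a+b)`) and `C`-module filtrations `D` (`D k·C b ≤ D (k+b)`): binomial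
inclusion `pow_le_iSup_mul_pow` (`J ≤ J' + C 1 ⇒ J^n ≤ Σ_{a≤n} C(n−a)·J'^a`), stability `iSup_mul_pow_le_of_le_sup'` /
`iSup_mul_pow_eq_of_le_sup` of `Σ_{k≤d} D k·J^(d−k)`, pair ideals moved inside `C 1`. §2 `span_pair_pow_le_iSup`
(`(z,w)^n ≤ Σ_{i+j=n} (z^i w^j)`). §3 «WORDS = FILTRATION» (`sup_iSup_eq_iSup_mul_pow`, `mul_pow_sup_iSup_eq_iSup_mul_pow`) and the
MOVE LEMMAS `sup_iSup_eq_of_move` / `mul_pow_sup_iSup_le_of_move` (`φ, ψ ∈ C 1` ⇒ the ideal does not see `z ↦ z+φ`, `w ↦ w+ψ`).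
§4 the cells are multiplicative: `alphaCell_mul_le` `(x^⌈ρk⌉)`, `deltaCell_mul_le` `(x,y)^⌈ρk⌉`, `betaCell_mul_le`
`(x^(⌊αk⌋+1)) + (x^⌈αk⌉·y^⌈ρk⌉)` (`0 ≤ α`), `betaStrictCell_mul_le` (the STRICT cells `(x^(⌊αk⌋+1)) + (x^⌈αk⌉·y^(⌊β₀k⌋+1))` are
a module over the `β`-cells), `betaStrictCell_zero` (`C⁺ 0 = (x, y)`). §5 the STRICT `β`-IDEAL
`I⁺(z,w) = (x,y)·(z,w)^d + Σ_{i+j<d} C⁺(d−i−j)·(z^i w^j)` is invariant under moves of `v`-weight `≥ 1` (`betaStrict_le_of_move`,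
`betaStrict_eq_of_move`) and **BRICK D — DISSOLUTION** `sub_sq_mem_of_dissolution`: `φ, ψ ∈ (x^(⌊α⌋+1)) + (x^⌈α⌉·y^⌈β₀⌉)` (the
dissolving translations `λM, μM`, `M = x^α y^β₀`, qualify) and the SOLVABILITY IDENTITY `f ≡ P + Q² (mod I⁺(z,w))`,
`P ∈ (z+φ, w+ψ)^d`, give `f − Q² ∈ (z',w')^d + I⁺(z',w')` — after translating and cleaning, `β > β₀` (bridges to the word `BetaGe`
in `…BetaPolygonMoves`; res-L0-w41-stub-1's p539704 `BetaPolygon.eq_translate_add_sq_of_translate_eq` is the graded solvability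
identity it consumes). Any commutative ring; in characteristic `2`, `f − Q² = f + Q²`.

[cite: CossartJannsenSaito2020, Def. 11.1, (11.4)] [cite: CossartPiltant2019, Def. 2.3] [folklore]
bears_on: LADDER-RESOLUTION L ★L-G4 W4.1 (crux `Steer`, binder hK4′, debt K-β1♭ bricks G1 / D).
-/

noncomputable section

-- `Summit.<S>.<S>.…` duplicates the summit name by design (single-problem summit).
set_option linter.dupNamespace false

open IsLocalRing

namespace Summit.ResolutionOfSingularities.ResolutionOfSingularities.Theorems.SwitchingDichotomy.BetaPolygonMoves

variable {S : Type} [CommRing S]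

/-! ## §1 Multiplicative filtrations: the binomial inclusion and stability under moves -/

/-- **Binomial inclusion.** If `J ≤ J' + C 1` for a multiplicative filtration `C`, then
`J ^ n ≤ Σ_{a ≤ n} C (n − a) · J' ^ a`. OURS. [folklore] -/
theorem pow_le_iSup_mul_pow {C : ℕ → Ideal S} (hC0 : C 0 = ⊤) (hC : ∀ a b, C a * C b ≤ C (a + b))
    {J J' : Ideal S} (hJ : J ≤ J' ⊔ C 1) :
    ∀ n : ℕ, J ^ n ≤ ⨆ (a : ℕ) (_ : a ≤ n), C (n - a) * J' ^ a
  | 0 => le_iSup₂_of_le 0 le_rfl (by simp [hC0])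
  | n + 1 => by
    have ih := pow_le_iSup_mul_pow hC0 hC hJ n
    calc J ^ (n + 1) = J ^ n * J := pow_succ J n
      _ ≤ (⨆ (a : ℕ) (_ : a ≤ n), C (n - a) * J' ^ a) * (J' ⊔ C 1) := Ideal.mul_mono ih hJ
      _ ≤ ⨆ (a : ℕ) (_ : a ≤ n + 1), C (n + 1 - a) * J' ^ a := by
        rw [Ideal.iSup_mul]
        refine iSup_le fun a => ?_
        rw [Ideal.iSup_mul]
        refine iSup_le fun ha => ?_
        rw [Ideal.mul_sup]
        refine sup_le ?_ ?_
        · refine le_iSup₂_of_le (a + 1) (by omega) ?_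
          rw [show n + 1 - (a + 1) = n - a by omega, pow_succ, mul_assoc]
        · refine le_iSup₂_of_le a (by omega) ?_
          calc C (n - a) * J' ^ a * C 1 = (C (n - a) * C 1) * J' ^ a := by ring
            _ ≤ C (n - a + 1) * J' ^ a := Ideal.mul_mono_left (hC _ _)
            _ = C (n + 1 - a) * J' ^ a := by rw [show n - a + 1 = n + 1 - a by omega]

/-- **Stability of filtration ideals under moves, two-filtration form.** If `J ≤ J' + C 1` and `D` is a `C`-MODULE filtration
(`D k · C b ≤ D (k + b)`; e.g. `D = C`, or the STRICT cells `D = C⁺` of brick D), then `Σ_k D k · J^(d−k) ≤ Σ_k D k · J'^(d−k)`.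
OURS. [folklore] -/
theorem iSup_mul_pow_le_of_le_sup' {C D : ℕ → Ideal S} (hC0 : C 0 = ⊤) (hC : ∀ a b, C a * C b ≤ C (a + b))
    (hD : ∀ k b, D k * C b ≤ D (k + b)) {J J' : Ideal S} (hJ : J ≤ J' ⊔ C 1) (d : ℕ) :
    (⨆ (k : ℕ) (_ : k ≤ d), D k * J ^ (d - k)) ≤ ⨆ (k : ℕ) (_ : k ≤ d), D k * J' ^ (d - k) := by
  refine iSup₂_le fun k hk => ?_
  calc D k * J ^ (d - k) ≤ D k * ⨆ (a : ℕ) (_ : a ≤ d - k), C (d - k - a) * J' ^ a :=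
        Ideal.mul_mono_right (pow_le_iSup_mul_pow hC0 hC hJ (d - k))
    _ ≤ ⨆ (k : ℕ) (_ : k ≤ d), D k * J' ^ (d - k) := by
        rw [Ideal.mul_iSup]
        refine iSup_le fun a => ?_
        rw [Ideal.mul_iSup]
        refine iSup_le fun ha => ?_
        refine le_iSup₂_of_le (d - a) (by omega) ?_
        calc D k * (C (d - k - a) * J' ^ a) = (D k * C (d - k - a)) * J' ^ a := by ring
          _ ≤ D (k + (d - k - a)) * J' ^ a := Ideal.mul_mono_left (hD _ _)
          _ = D (d - a) * J' ^ (d - (d - a)) := by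
              rw [show k + (d - k - a) = d - a by omega, show d - (d - a) = a by omega]

/-- The same as an EQUALITY when the move is invertible (`J ≤ J' + C 1` and `J' ≤ J + C 1`). -/
theorem iSup_mul_pow_eq_of_le_sup {C : ℕ → Ideal S} (hC0 : C 0 = ⊤) (hC : ∀ a b, C a * C b ≤ C (a + b))
    {J J' : Ideal S} (hJ : J ≤ J' ⊔ C 1) (hJ' : J' ≤ J ⊔ C 1) (d : ℕ) :
    (⨆ (k : ℕ) (_ : k ≤ d), C k * J ^ (d - k)) = ⨆ (k : ℕ) (_ : k ≤ d), C k * J' ^ (d - k) :=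
  le_antisymm (iSup_mul_pow_le_of_le_sup' hC0 hC hC hJ d) (iSup_mul_pow_le_of_le_sup' hC0 hC hC hJ' d)

/-- A pair ideal moved inside `C 1`: `(z, w) ≤ (z + φ, w + ψ) + C 1` for `φ, ψ ∈ C 1`. -/
theorem span_pair_le_span_pair_add_sup {C1 : Ideal S} {z w φ ψ : S} (hφ : φ ∈ C1) (hψ : ψ ∈ C1) :
    Ideal.span {z, w} ≤ Ideal.span {z + φ, w + ψ} ⊔ C1 := by
  rw [Ideal.span_le]
  rintro a (rfl | rfl)
  · have : a = (a + φ) - φ := by ring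
    rw [SetLike.mem_coe, this]
    exact Ideal.sub_mem _ (Ideal.mem_sup_left (Ideal.subset_span (by simp))) (Ideal.mem_sup_right hφ)
  · have : a = (a + ψ) - ψ := by ring
    rw [SetLike.mem_coe, this]
    exact Ideal.sub_mem _ (Ideal.mem_sup_left (Ideal.subset_span (by simp))) (Ideal.mem_sup_right hψ)

/-- … and back: `(z + φ, w + ψ) ≤ (z, w) + C 1`. -/
theorem span_pair_add_le_span_pair_sup {C1 : Ideal S} {z w φ ψ : S} (hφ : φ ∈ C1) (hψ : ψ ∈ C1) :
    Ideal.span {z + φ, w + ψ} ≤ Ideal.span {z, w} ⊔ C1 := by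
  simpa using span_pair_le_span_pair_add_sup (z := z + φ) (w := w + ψ) (C1.neg_mem hφ) (C1.neg_mem hψ)

/-! ## §2 Powers of a pair ideal: `(z, w)^n = Σ_{i+j=n} (z^i · w^j)` -/

/-- `z ^ i * w ^ j ∈ (z, w) ^ (i + j)`. -/
theorem pow_mul_pow_mem_span_pair_pow (z w : S) (i j : ℕ) : z ^ i * w ^ j ∈ Ideal.span {z, w} ^ (i + j) := by
  rw [pow_add]
  exact Ideal.mul_mem_mul (Ideal.pow_mem_pow (Ideal.subset_span (by simp)) i)
    (Ideal.pow_mem_pow (Ideal.subset_span (by simp)) j)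

/-- `(z, w) ^ n ≤ Σ_{i + j = n} (z ^ i · w ^ j)` (binomial inclusion with the filtration `C k = (w ^ k)`). -/
theorem span_pair_pow_le_iSup (z w : S) (n : ℕ) :
    Ideal.span {z, w} ^ n ≤ ⨆ (i : ℕ) (j : ℕ) (_ : i + j = n), Ideal.span {z ^ i * w ^ j} := by
  have hC0 : Ideal.span {w ^ 0} = (⊤ : Ideal S) := by simp
  have hC : ∀ a b : ℕ, Ideal.span {w ^ a} * Ideal.span {w ^ b} ≤ Ideal.span ({w ^ (a + b)} : Set S) :=
    fun a b => by rw [Ideal.span_singleton_mul_span_singleton, ← pow_add]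
  have hJ : Ideal.span {z, w} ≤ Ideal.span {z} ⊔ Ideal.span ({w ^ 1} : Set S) := by
    rw [pow_one, ← Ideal.span_union, Set.singleton_union]
  refine (pow_le_iSup_mul_pow (C := fun k => Ideal.span {w ^ k}) hC0 hC hJ n).trans ?_
  refine iSup₂_le fun a ha => le_iSup_of_le a (le_iSup₂_of_le (n - a) (by omega) ?_)
  rw [Ideal.span_singleton_pow, Ideal.span_singleton_mul_span_singleton, mul_comm]

/-! ## §3 «Words = filtration» and the MOVE LEMMAS -/

/-- **Words = filtration, general zeroth cell.** For any `D : ℕ → Ideal S`: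
`D 0 · (z, w)^d + Σ_{i+j<d} D (d−i−j) · (z^i w^j) = Σ_{k ≤ d} D k · (z, w)^(d−k)`. OURS. [folklore] -/
theorem mul_pow_sup_iSup_eq_iSup_mul_pow (D : ℕ → Ideal S) (z w : S) (d : ℕ) :
    D 0 * Ideal.span {z, w} ^ d ⊔ (⨆ (i : ℕ) (j : ℕ) (_ : i + j < d), D (d - i - j) * Ideal.span {z ^ i * w ^ j}) =
      ⨆ (k : ℕ) (_ : k ≤ d), D k * Ideal.span {z, w} ^ (d - k) := by
  refine le_antisymm (sup_le ?_ ?_) (iSup₂_le fun k hk => ?_)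
  · exact le_iSup₂_of_le 0 (Nat.zero_le d) (by rw [Nat.sub_zero])
  · refine iSup_le fun i => iSup_le fun j => iSup_le fun hij => le_iSup₂_of_le (d - i - j) (by omega) ?_
    refine Ideal.mul_mono_right ?_
    rw [Ideal.span_singleton_le_iff_mem, show d - (d - i - j) = i + j by omega]
    exact pow_mul_pow_mem_span_pair_pow z w i j
  · rcases Nat.eq_zero_or_pos k with rfl | hk0
    · exact le_sup_of_le_left (by rw [Nat.sub_zero])
    refine le_sup_of_le_right ?_
    calc D k * Ideal.span {z, w} ^ (d - k)
        ≤ D k * ⨆ (i : ℕ) (j : ℕ) (_ : i + j = d - k), Ideal.span {z ^ i * w ^ j} :=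
          Ideal.mul_mono_right (span_pair_pow_le_iSup z w (d - k))
      _ ≤ ⨆ (i : ℕ) (j : ℕ) (_ : i + j < d), D (d - i - j) * Ideal.span {z ^ i * w ^ j} := by
          rw [Ideal.mul_iSup]
          refine iSup_le fun i => ?_
          rw [Ideal.mul_iSup]
          refine iSup_le fun j => ?_
          rw [Ideal.mul_iSup]
          refine iSup_le fun hij => ?_
          refine le_iSup_of_le i (le_iSup_of_le j (le_iSup_of_le (by omega) ?_))
          rw [show d - i - j = k by omega]

/-- **Words = filtration.** For a filtration `C` with `C 0 = ⊤`:
`(z, w)^d + Σ_{i+j<d} C (d−i−j) · (z^i w^j) = Σ_{k ≤ d} C k · (z, w)^(d−k)`. OURS. [folklore] -/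
theorem sup_iSup_eq_iSup_mul_pow {C : ℕ → Ideal S} (hC0 : C 0 = ⊤) (z w : S) (d : ℕ) :
    Ideal.span {z, w} ^ d ⊔ (⨆ (i : ℕ) (j : ℕ) (_ : i + j < d), C (d - i - j) * Ideal.span {z ^ i * w ^ j}) =
      ⨆ (k : ℕ) (_ : k ≤ d), C k * Ideal.span {z, w} ^ (d - k) := by
  rw [← mul_pow_sup_iSup_eq_iSup_mul_pow C z w d, hC0, Ideal.top_mul]

/-- **Moves of weight `≥ 1` on a `C`-module filtration `D`** (two-filtration form of `sup_iSup_eq_of_move`): for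
`φ, ψ ∈ C 1`, `D 0·(z,w)^d + Σ D(d−i−j)·(z^i w^j) ≤ D 0·(z',w')^d + Σ D(d−i−j)·(z'^i w'^j)`, `z' = z + φ`, `w' = w + ψ`.
OURS. [folklore] -/
theorem mul_pow_sup_iSup_le_of_move {C D : ℕ → Ideal S} (hC0 : C 0 = ⊤) (hC : ∀ a b, C a * C b ≤ C (a + b))
    (hD : ∀ k b, D k * C b ≤ D (k + b)) (z w : S) {φ ψ : S} (hφ : φ ∈ C 1) (hψ : ψ ∈ C 1) (d : ℕ) :
    D 0 * Ideal.span {z, w} ^ d ⊔ (⨆ (i : ℕ) (j : ℕ) (_ : i + j < d), D (d - i - j) * Ideal.span {z ^ i * w ^ j}) ≤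
      D 0 * Ideal.span {z + φ, w + ψ} ^ d ⊔
        (⨆ (i : ℕ) (j : ℕ) (_ : i + j < d), D (d - i - j) * Ideal.span {(z + φ) ^ i * (w + ψ) ^ j}) := by
  rw [mul_pow_sup_iSup_eq_iSup_mul_pow, mul_pow_sup_iSup_eq_iSup_mul_pow]
  exact iSup_mul_pow_le_of_le_sup' hC0 hC hD (span_pair_le_span_pair_add_sup hφ hψ) d

/-- **Moves of weight `≥ 1` do not change a threshold ideal.** For a multiplicative filtration `C` and `φ, ψ ∈ C 1`:
`(z, w)^d + Σ C(d−i−j)·(z^i w^j) = (z', w')^d + Σ C(d−i−j)·(z'^i w'^j)` with `z' = z + φ`, `w' = w + ψ`. OURS. [folklore] -/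
theorem sup_iSup_eq_of_move {C : ℕ → Ideal S} (hC0 : C 0 = ⊤) (hC : ∀ a b, C a * C b ≤ C (a + b))
    (z w : S) {φ ψ : S} (hφ : φ ∈ C 1) (hψ : ψ ∈ C 1) (d : ℕ) :
    Ideal.span {z, w} ^ d ⊔ (⨆ (i : ℕ) (j : ℕ) (_ : i + j < d), C (d - i - j) * Ideal.span {z ^ i * w ^ j}) =
      Ideal.span {z + φ, w + ψ} ^ d ⊔
        (⨆ (i : ℕ) (j : ℕ) (_ : i + j < d), C (d - i - j) * Ideal.span {(z + φ) ^ i * (w + ψ) ^ j}) := by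
  rw [sup_iSup_eq_iSup_mul_pow hC0, sup_iSup_eq_iSup_mul_pow hC0]
  exact iSup_mul_pow_eq_of_le_sup hC0 hC (span_pair_le_span_pair_add_sup hφ hψ)
    (span_pair_add_le_span_pair_sup hφ hψ) d

/-! ## §4 The cells: floor / ceiling arithmetic -/

/-- `⌊s + t⌋₊ ≤ ⌊s⌋₊ + ⌈t⌉₊` for `0 ≤ s`. -/
theorem floor_add_le_floor_add_ceil {s t : ℚ} (hs : 0 ≤ s) (ht : 0 ≤ t) : ⌊s + t⌋₊ ≤ ⌊s⌋₊ + ⌈t⌉₊ := by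
  have h1 : (⌊s + t⌋₊ : ℚ) ≤ s + t := Nat.floor_le (by positivity)
  have : (⌊s + t⌋₊ : ℚ) < ⌊s⌋₊ + ⌈t⌉₊ + 1 := by linarith [Nat.lt_floor_add_one s, Nat.le_ceil t]
  have : ⌊s + t⌋₊ < ⌊s⌋₊ + ⌈t⌉₊ + 1 := by exact_mod_cast this
  omega

/-- The threshold arithmetic for `β₀ < ρ'`: `⌊β₀ n⌋ + 1 ≤ ⌈ρ' n⌉` for `n ≥ 1` (`0 ≤ β₀`). -/
theorem floor_add_one_le_ceil_of_lt {β₀ ρ' : ℚ} (hβ : 0 ≤ β₀) (h : β₀ < ρ') {n : ℕ} (hn : 1 ≤ n) :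
    ⌊β₀ * (n : ℚ)⌋₊ + 1 ≤ ⌈ρ' * (n : ℚ)⌉₊ := by
  have hn' : (0 : ℚ) < n := by exact_mod_cast hn
  have h1 : (⌊β₀ * (n : ℚ)⌋₊ : ℚ) ≤ β₀ * n := Nat.floor_le (by positivity)
  have : (⌊β₀ * (n : ℚ)⌋₊ : ℚ) < ⌈ρ' * (n : ℚ)⌉₊ := by
    linarith [mul_lt_mul_of_pos_right h hn', Nat.le_ceil (ρ' * (n : ℚ))]
  exact_mod_cast this

/-- The `α`-filtration `C k = (x ^ ⌈ρ k⌉)` is multiplicative. -/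
theorem alphaCell_mul_le (x : S) (ρ : ℚ) (a b : ℕ) :
    Ideal.span {x ^ ⌈ρ * (a : ℚ)⌉₊} * Ideal.span {x ^ ⌈ρ * (b : ℚ)⌉₊} ≤
      Ideal.span ({x ^ ⌈ρ * ((a + b : ℕ) : ℚ)⌉₊} : Set S) := by
  rw [Ideal.span_singleton_mul_span_singleton, ← pow_add, Ideal.span_singleton_le_span_singleton]
  refine pow_dvd_pow x ?_
  rw [Nat.cast_add, mul_add]
  exact Nat.ceil_add_le _ _

/-- The `δ`-filtration `C k = (x, y) ^ ⌈ρ k⌉` is multiplicative. -/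
theorem deltaCell_mul_le (x y : S) (ρ : ℚ) (a b : ℕ) :
    Ideal.span {x, y} ^ ⌈ρ * (a : ℚ)⌉₊ * Ideal.span {x, y} ^ ⌈ρ * (b : ℚ)⌉₊ ≤
      Ideal.span ({x, y} : Set S) ^ ⌈ρ * ((a + b : ℕ) : ℚ)⌉₊ := by
  rw [← pow_add]
  refine Ideal.pow_le_pow_right ?_
  rw [Nat.cast_add, mul_add]
  exact Nat.ceil_add_le _ _

/-- The `β`-filtration `C k = (x ^ (⌊α k⌋ + 1)) + (x ^ ⌈α k⌉ · y ^ ⌈ρ k⌉)` is multiplicative (`0 ≤ α`). -/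
theorem betaCell_mul_le (x y : S) {α : ℚ} (hα : 0 ≤ α) (ρ : ℚ) (a b : ℕ) :
    (Ideal.span {x ^ (⌊α * (a : ℚ)⌋₊ + 1)} ⊔ Ideal.span {x ^ ⌈α * (a : ℚ)⌉₊ * y ^ ⌈ρ * (a : ℚ)⌉₊}) *
        (Ideal.span {x ^ (⌊α * (b : ℚ)⌋₊ + 1)} ⊔ Ideal.span {x ^ ⌈α * (b : ℚ)⌉₊ * y ^ ⌈ρ * (b : ℚ)⌉₊}) ≤
      Ideal.span {x ^ (⌊α * ((a + b : ℕ) : ℚ)⌋₊ + 1)} ⊔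
        Ideal.span ({x ^ ⌈α * ((a + b : ℕ) : ℚ)⌉₊ * y ^ ⌈ρ * ((a + b : ℕ) : ℚ)⌉₊} : Set S) := by
  have hαa : 0 ≤ α * (a : ℚ) := by positivity
  have hαb : 0 ≤ α * (b : ℚ) := by positivity
  have hsum : α * ((a + b : ℕ) : ℚ) = α * (a : ℚ) + α * (b : ℚ) := by rw [Nat.cast_add, mul_add]
  have hsum' : ρ * ((a + b : ℕ) : ℚ) = ρ * (a : ℚ) + ρ * (b : ℚ) := by rw [Nat.cast_add, mul_add]
  -- the four exponent inequalities
  have e1 : ⌊α * ((a + b : ℕ) : ℚ)⌋₊ + 1 ≤ (⌊α * (a : ℚ)⌋₊ + 1) + (⌊α * (b : ℚ)⌋₊ + 1) := by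
    rw [hsum]; have := floor_add_le_floor_add_ceil hαa hαb
    have := Nat.ceil_le_floor_add_one (α * (b : ℚ)); omega
  have e2 : ⌊α * ((a + b : ℕ) : ℚ)⌋₊ + 1 ≤ (⌊α * (a : ℚ)⌋₊ + 1) + ⌈α * (b : ℚ)⌉₊ := by
    rw [hsum]; have := floor_add_le_floor_add_ceil hαa hαb; omega
  have e3 : ⌊α * ((a + b : ℕ) : ℚ)⌋₊ + 1 ≤ ⌈α * (a : ℚ)⌉₊ + (⌊α * (b : ℚ)⌋₊ + 1) := by
    rw [hsum, add_comm (α * (a : ℚ))]; have := floor_add_le_floor_add_ceil hαb hαa; omega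
  have e4 : ⌈α * ((a + b : ℕ) : ℚ)⌉₊ ≤ ⌈α * (a : ℚ)⌉₊ + ⌈α * (b : ℚ)⌉₊ := by
    rw [hsum]; exact Nat.ceil_add_le _ _
  have e5 : ⌈ρ * ((a + b : ℕ) : ℚ)⌉₊ ≤ ⌈ρ * (a : ℚ)⌉₊ + ⌈ρ * (b : ℚ)⌉₊ := by
    rw [hsum']; exact Nat.ceil_add_le _ _
  rw [Ideal.mul_sup, Ideal.sup_mul, Ideal.sup_mul]
  simp only [Ideal.span_singleton_mul_span_singleton]
  refine sup_le (sup_le ?_ ?_) (sup_le ?_ ?_)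
  · refine le_sup_of_le_left (Ideal.span_singleton_le_span_singleton.mpr ?_)
    rw [← pow_add]; exact pow_dvd_pow x e1
  · refine le_sup_of_le_left (Ideal.span_singleton_le_span_singleton.mpr ?_)
    rw [show x ^ ⌈α * (a : ℚ)⌉₊ * y ^ ⌈ρ * (a : ℚ)⌉₊ * x ^ (⌊α * (b : ℚ)⌋₊ + 1)
        = x ^ (⌈α * (a : ℚ)⌉₊ + (⌊α * (b : ℚ)⌋₊ + 1)) * y ^ ⌈ρ * (a : ℚ)⌉₊ by ring]
    exact Dvd.dvd.mul_right (pow_dvd_pow x e3) _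
  · refine le_sup_of_le_left (Ideal.span_singleton_le_span_singleton.mpr ?_)
    rw [show x ^ (⌊α * (a : ℚ)⌋₊ + 1) * (x ^ ⌈α * (b : ℚ)⌉₊ * y ^ ⌈ρ * (b : ℚ)⌉₊)
        = x ^ ((⌊α * (a : ℚ)⌋₊ + 1) + ⌈α * (b : ℚ)⌉₊) * y ^ ⌈ρ * (b : ℚ)⌉₊ by ring]
    exact Dvd.dvd.mul_right (pow_dvd_pow x e2) _
  · refine le_sup_of_le_right (Ideal.span_singleton_le_span_singleton.mpr ?_)
    rw [show x ^ ⌈α * (a : ℚ)⌉₊ * y ^ ⌈ρ * (a : ℚ)⌉₊ * (x ^ ⌈α * (b : ℚ)⌉₊ * y ^ ⌈ρ * (b : ℚ)⌉₊)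
        = x ^ (⌈α * (a : ℚ)⌉₊ + ⌈α * (b : ℚ)⌉₊) * y ^ (⌈ρ * (a : ℚ)⌉₊ + ⌈ρ * (b : ℚ)⌉₊) by ring]
    exact mul_dvd_mul (pow_dvd_pow x e4) (pow_dvd_pow y e5)

/-- The strict `β`-cells are a module over the `β`-cells: `C⁺ k · C b ≤ C⁺ (k + b)` (`0 ≤ α`, `0 ≤ β₀`). -/
theorem betaStrictCell_mul_le (x y : S) {α β₀ : ℚ} (hα : 0 ≤ α) (hβ : 0 ≤ β₀) (k b : ℕ) :
    (Ideal.span {x ^ (⌊α * (k : ℚ)⌋₊ + 1)} ⊔ Ideal.span {x ^ ⌈α * (k : ℚ)⌉₊ * y ^ (⌊β₀ * (k : ℚ)⌋₊ + 1)}) *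
        (Ideal.span {x ^ (⌊α * (b : ℚ)⌋₊ + 1)} ⊔ Ideal.span {x ^ ⌈α * (b : ℚ)⌉₊ * y ^ ⌈β₀ * (b : ℚ)⌉₊}) ≤
      Ideal.span {x ^ (⌊α * ((k + b : ℕ) : ℚ)⌋₊ + 1)} ⊔
        Ideal.span ({x ^ ⌈α * ((k + b : ℕ) : ℚ)⌉₊ * y ^ (⌊β₀ * ((k + b : ℕ) : ℚ)⌋₊ + 1)} : Set S) := by
  have hαk : 0 ≤ α * (k : ℚ) := by positivity
  have hαb : 0 ≤ α * (b : ℚ) := by positivity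
  have hβk : 0 ≤ β₀ * (k : ℚ) := by positivity
  have hβb : 0 ≤ β₀ * (b : ℚ) := by positivity
  have hsum : α * ((k + b : ℕ) : ℚ) = α * (k : ℚ) + α * (b : ℚ) := by rw [Nat.cast_add, mul_add]
  have hsum' : β₀ * ((k + b : ℕ) : ℚ) = β₀ * (k : ℚ) + β₀ * (b : ℚ) := by rw [Nat.cast_add, mul_add]
  have e1 : ⌊α * ((k + b : ℕ) : ℚ)⌋₊ + 1 ≤ (⌊α * (k : ℚ)⌋₊ + 1) + (⌊α * (b : ℚ)⌋₊ + 1) := by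
    rw [hsum]; have := floor_add_le_floor_add_ceil hαk hαb
    have := Nat.ceil_le_floor_add_one (α * (b : ℚ)); omega
  have e2 : ⌊α * ((k + b : ℕ) : ℚ)⌋₊ + 1 ≤ (⌊α * (k : ℚ)⌋₊ + 1) + ⌈α * (b : ℚ)⌉₊ := by
    rw [hsum]; have := floor_add_le_floor_add_ceil hαk hαb; omega
  have e3 : ⌊α * ((k + b : ℕ) : ℚ)⌋₊ + 1 ≤ ⌈α * (k : ℚ)⌉₊ + (⌊α * (b : ℚ)⌋₊ + 1) := by
    rw [hsum, add_comm (α * (k : ℚ))]; have := floor_add_le_floor_add_ceil hαb hαk; omega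
  have e4 : ⌈α * ((k + b : ℕ) : ℚ)⌉₊ ≤ ⌈α * (k : ℚ)⌉₊ + ⌈α * (b : ℚ)⌉₊ := by
    rw [hsum]; exact Nat.ceil_add_le _ _
  have e5 : ⌊β₀ * ((k + b : ℕ) : ℚ)⌋₊ + 1 ≤ (⌊β₀ * (k : ℚ)⌋₊ + 1) + ⌈β₀ * (b : ℚ)⌉₊ := by
    rw [hsum']; have := floor_add_le_floor_add_ceil hβk hβb; omega
  rw [Ideal.mul_sup, Ideal.sup_mul, Ideal.sup_mul]
  simp only [Ideal.span_singleton_mul_span_singleton]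
  refine sup_le (sup_le ?_ ?_) (sup_le ?_ ?_)
  · refine le_sup_of_le_left (Ideal.span_singleton_le_span_singleton.mpr ?_)
    rw [← pow_add]; exact pow_dvd_pow x e1
  · refine le_sup_of_le_left (Ideal.span_singleton_le_span_singleton.mpr ?_)
    rw [show x ^ ⌈α * (k : ℚ)⌉₊ * y ^ (⌊β₀ * (k : ℚ)⌋₊ + 1) * x ^ (⌊α * (b : ℚ)⌋₊ + 1)
        = x ^ (⌈α * (k : ℚ)⌉₊ + (⌊α * (b : ℚ)⌋₊ + 1)) * y ^ (⌊β₀ * (k : ℚ)⌋₊ + 1) by ring]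
    exact Dvd.dvd.mul_right (pow_dvd_pow x e3) _
  · refine le_sup_of_le_left (Ideal.span_singleton_le_span_singleton.mpr ?_)
    rw [show x ^ (⌊α * (k : ℚ)⌋₊ + 1) * (x ^ ⌈α * (b : ℚ)⌉₊ * y ^ ⌈β₀ * (b : ℚ)⌉₊)
        = x ^ ((⌊α * (k : ℚ)⌋₊ + 1) + ⌈α * (b : ℚ)⌉₊) * y ^ ⌈β₀ * (b : ℚ)⌉₊ by ring]
    exact Dvd.dvd.mul_right (pow_dvd_pow x e2) _
  · refine le_sup_of_le_right (Ideal.span_singleton_le_span_singleton.mpr ?_)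
    rw [show x ^ ⌈α * (k : ℚ)⌉₊ * y ^ (⌊β₀ * (k : ℚ)⌋₊ + 1) * (x ^ ⌈α * (b : ℚ)⌉₊ * y ^ ⌈β₀ * (b : ℚ)⌉₊)
        = x ^ (⌈α * (k : ℚ)⌉₊ + ⌈α * (b : ℚ)⌉₊) * y ^ ((⌊β₀ * (k : ℚ)⌋₊ + 1) + ⌈β₀ * (b : ℚ)⌉₊) by ring]
    exact mul_dvd_mul (pow_dvd_pow x e4) (pow_dvd_pow y e5)

/-- The zeroth strict cell is `(x, y)`. -/
theorem betaStrictCell_zero (x y : S) (α β₀ : ℚ) :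
    Ideal.span {x ^ (⌊α * ((0 : ℕ) : ℚ)⌋₊ + 1)} ⊔
        Ideal.span {x ^ ⌈α * ((0 : ℕ) : ℚ)⌉₊ * y ^ (⌊β₀ * ((0 : ℕ) : ℚ)⌋₊ + 1)} = Ideal.span ({x, y} : Set S) := by
  simp only [Nat.cast_zero, mul_zero, Nat.floor_zero, zero_add, pow_one, Nat.ceil_zero, pow_zero, one_mul]
  rw [← Ideal.span_union, Set.singleton_union]

/-! ## §5 The STRICT `β`-ideal `I⁺(z, w) = (x, y)·(z, w)^d + Σ_{i+j<d} C⁺(d−i−j)·(z^i w^j)` (monomials STRICTLY beyond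
`v = (α, β₀)`; `f ∈ (z, w)^d + I⁺(z, w)` is «`β > β₀` in the coordinates `(z, w)`») under moves, and DISSOLUTION (brick D) -/

/-- **The STRICT `β`-ideal only grows under moves of `v`-weight `≥ 1`** (`v = (α, β₀)`, `0 ≤ α, β₀`;
`φ, ψ ∈ (x^(⌊α⌋+1)) + (x^⌈α⌉ · y^⌈β₀⌉)`; here `C⁺ 0` is still spelled as a cell, cf. `betaStrictCell_zero`). OURS. [folklore] -/
theorem betaStrict_le_of_move (x y z w : S) {α β₀ : ℚ} (hα : 0 ≤ α) (hβ : 0 ≤ β₀) {φ ψ : S}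
    (hφ : φ ∈ Ideal.span {x ^ (⌊α⌋₊ + 1)} ⊔ Ideal.span {x ^ ⌈α⌉₊ * y ^ ⌈β₀⌉₊})
    (hψ : ψ ∈ Ideal.span {x ^ (⌊α⌋₊ + 1)} ⊔ Ideal.span {x ^ ⌈α⌉₊ * y ^ ⌈β₀⌉₊}) (d : ℕ) :
    (Ideal.span {x ^ (⌊α * ((0 : ℕ) : ℚ)⌋₊ + 1)} ⊔
          Ideal.span {x ^ ⌈α * ((0 : ℕ) : ℚ)⌉₊ * y ^ (⌊β₀ * ((0 : ℕ) : ℚ)⌋₊ + 1)}) * Ideal.span {z, w} ^ d ⊔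
        (⨆ (i : ℕ) (j : ℕ) (_ : i + j < d),
          (Ideal.span {x ^ (⌊α * ((d - i - j : ℕ) : ℚ)⌋₊ + 1)} ⊔
              Ideal.span {x ^ ⌈α * ((d - i - j : ℕ) : ℚ)⌉₊ * y ^ (⌊β₀ * ((d - i - j : ℕ) : ℚ)⌋₊ + 1)}) *
            Ideal.span {z ^ i * w ^ j}) ≤
      (Ideal.span {x ^ (⌊α * ((0 : ℕ) : ℚ)⌋₊ + 1)} ⊔
          Ideal.span {x ^ ⌈α * ((0 : ℕ) : ℚ)⌉₊ * y ^ (⌊β₀ * ((0 : ℕ) : ℚ)⌋₊ + 1)}) * Ideal.span {z + φ, w + ψ} ^ d ⊔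
        (⨆ (i : ℕ) (j : ℕ) (_ : i + j < d),
          (Ideal.span {x ^ (⌊α * ((d - i - j : ℕ) : ℚ)⌋₊ + 1)} ⊔
              Ideal.span {x ^ ⌈α * ((d - i - j : ℕ) : ℚ)⌉₊ * y ^ (⌊β₀ * ((d - i - j : ℕ) : ℚ)⌋₊ + 1)}) *
            Ideal.span {(z + φ) ^ i * (w + ψ) ^ j}) := by
  have hC0 : Ideal.span {x ^ (⌊α * ((0 : ℕ) : ℚ)⌋₊ + 1)} ⊔
      Ideal.span {x ^ ⌈α * ((0 : ℕ) : ℚ)⌉₊ * y ^ ⌈β₀ * ((0 : ℕ) : ℚ)⌉₊} = (⊤ : Ideal S) := by simp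
  have h1 : Ideal.span {x ^ (⌊α⌋₊ + 1)} ⊔ Ideal.span {x ^ ⌈α⌉₊ * y ^ ⌈β₀⌉₊} =
      Ideal.span {x ^ (⌊α * ((1 : ℕ) : ℚ)⌋₊ + 1)} ⊔
        Ideal.span ({x ^ ⌈α * ((1 : ℕ) : ℚ)⌉₊ * y ^ ⌈β₀ * ((1 : ℕ) : ℚ)⌉₊} : Set S) := by
    simp only [Nat.cast_one, mul_one]
  rw [h1] at hφ hψ
  exact mul_pow_sup_iSup_le_of_move
    (C := fun k => Ideal.span {x ^ (⌊α * (k : ℚ)⌋₊ + 1)} ⊔ Ideal.span {x ^ ⌈α * (k : ℚ)⌉₊ * y ^ ⌈β₀ * (k : ℚ)⌉₊})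
    (D := fun k => Ideal.span {x ^ (⌊α * (k : ℚ)⌋₊ + 1)} ⊔
      Ideal.span {x ^ ⌈α * (k : ℚ)⌉₊ * y ^ (⌊β₀ * (k : ℚ)⌋₊ + 1)})
    hC0 (fun a b => betaCell_mul_le x y hα β₀ a b) (fun k b => betaStrictCell_mul_le x y hα hβ k b) z w hφ hψ d

/-- The strict `β`-ideal `I⁺(z, w) = (x, y)·(z, w)^d + Σ C⁺(d−i−j)·(z^i w^j)` is INVARIANT under moves of `v`-weight `≥ 1`
(apply `betaStrict_le_of_move` to `(φ, ψ)` and to `(−φ, −ψ)`). OURS. [folklore] -/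
theorem betaStrict_eq_of_move (x y z w : S) {α β₀ : ℚ} (hα : 0 ≤ α) (hβ : 0 ≤ β₀) {φ ψ : S}
    (hφ : φ ∈ Ideal.span {x ^ (⌊α⌋₊ + 1)} ⊔ Ideal.span {x ^ ⌈α⌉₊ * y ^ ⌈β₀⌉₊})
    (hψ : ψ ∈ Ideal.span {x ^ (⌊α⌋₊ + 1)} ⊔ Ideal.span {x ^ ⌈α⌉₊ * y ^ ⌈β₀⌉₊}) (d : ℕ) :
    Ideal.span {x, y} * Ideal.span {z, w} ^ d ⊔
        (⨆ (i : ℕ) (j : ℕ) (_ : i + j < d),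
          (Ideal.span {x ^ (⌊α * ((d - i - j : ℕ) : ℚ)⌋₊ + 1)} ⊔
              Ideal.span {x ^ ⌈α * ((d - i - j : ℕ) : ℚ)⌉₊ * y ^ (⌊β₀ * ((d - i - j : ℕ) : ℚ)⌋₊ + 1)}) *
            Ideal.span {z ^ i * w ^ j}) =
      Ideal.span {x, y} * Ideal.span {z + φ, w + ψ} ^ d ⊔
        (⨆ (i : ℕ) (j : ℕ) (_ : i + j < d),
          (Ideal.span {x ^ (⌊α * ((d - i - j : ℕ) : ℚ)⌋₊ + 1)} ⊔
              Ideal.span {x ^ ⌈α * ((d - i - j : ℕ) : ℚ)⌉₊ * y ^ (⌊β₀ * ((d - i - j : ℕ) : ℚ)⌋₊ + 1)}) *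
            Ideal.span {(z + φ) ^ i * (w + ψ) ^ j}) := by
  have h1 := betaStrict_le_of_move x y z w hα hβ hφ hψ d
  have h2 := betaStrict_le_of_move x y (z + φ) (w + ψ) hα hβ (neg_mem hφ) (neg_mem hψ) d
  rw [betaStrictCell_zero] at h1 h2
  simp only [add_neg_cancel_right] at h2
  exact le_antisymm h1 h2

/-- **DISSOLUTION (brick D, ideal level).** Let `v = (α, β₀)` (`0 ≤ α, β₀`), let `φ, ψ` be moves of `v`-weight `≥ 1`
(`φ, ψ ∈ (x^(⌊α⌋+1)) + (x^⌈α⌉·y^⌈β₀⌉)`; the dissolving translations `λ·M`, `μ·M`, `M = x^α y^β₀` for `v ∈ ℤ²`, qualify), and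
suppose the SOLVABILITY IDENTITY `f ≡ P + Q²  (mod I⁺(z, w))` with `P ∈ (z + φ, w + ψ)^d` (e.g. `P = Ψ(z + φ, w + ψ)`). Then in
the new coordinates `z' = z + φ`, `w' = w + ψ` the cleaned element `f − Q²` lies in `(z', w')^d + I⁺(z', w')`: its `β` on the
column `a = α` is `> β₀`. (Any commutative ring; in characteristic `2`, `f − Q² = f + Q²`.) OURS. [folklore] -/
theorem sub_sq_mem_of_dissolution (x y z w : S) {α β₀ : ℚ} (hα : 0 ≤ α) (hβ : 0 ≤ β₀) {φ ψ : S}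
    (hφ : φ ∈ Ideal.span {x ^ (⌊α⌋₊ + 1)} ⊔ Ideal.span {x ^ ⌈α⌉₊ * y ^ ⌈β₀⌉₊})
    (hψ : ψ ∈ Ideal.span {x ^ (⌊α⌋₊ + 1)} ⊔ Ideal.span {x ^ ⌈α⌉₊ * y ^ ⌈β₀⌉₊}) {d : ℕ} {f P Q : S}
    (hP : P ∈ Ideal.span {z + φ, w + ψ} ^ d)
    (hf : f - (P + Q ^ 2) ∈ Ideal.span {x, y} * Ideal.span {z, w} ^ d ⊔
        ⨆ (i : ℕ) (j : ℕ) (_ : i + j < d),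
          (Ideal.span {x ^ (⌊α * ((d - i - j : ℕ) : ℚ)⌋₊ + 1)} ⊔
              Ideal.span {x ^ ⌈α * ((d - i - j : ℕ) : ℚ)⌉₊ * y ^ (⌊β₀ * ((d - i - j : ℕ) : ℚ)⌋₊ + 1)}) *
            Ideal.span {z ^ i * w ^ j}) :
    f - Q ^ 2 ∈ Ideal.span {z + φ, w + ψ} ^ d ⊔
      (Ideal.span {x, y} * Ideal.span {z + φ, w + ψ} ^ d ⊔
        ⨆ (i : ℕ) (j : ℕ) (_ : i + j < d),
          (Ideal.span {x ^ (⌊α * ((d - i - j : ℕ) : ℚ)⌋₊ + 1)} ⊔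
              Ideal.span {x ^ ⌈α * ((d - i - j : ℕ) : ℚ)⌉₊ * y ^ (⌊β₀ * ((d - i - j : ℕ) : ℚ)⌋₊ + 1)}) *
            Ideal.span {(z + φ) ^ i * (w + ψ) ^ j}) := by
  have hmove := betaStrict_le_of_move x y z w hα hβ hφ hψ d
  rw [betaStrictCell_zero] at hmove
  rw [show f - Q ^ 2 = P + (f - (P + Q ^ 2)) by ring]
  exact Ideal.add_mem _ (Ideal.mem_sup_left hP) (Ideal.mem_sup_right (hmove hf))

end Summit.ResolutionOfSingularities.ResolutionOfSingularities.Theorems.SwitchingDichotomy.BetaPolygonMoves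
end
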